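import Summits.KontsevichZagierPeriods.KontsevichZagierPeriods.Theorems.HurwitzMicroSectorsHurwitzSectorComplementStubSymReductionKit
import Summits.KontsevichZagierPeriods.KontsevichZagierPeriods.Theorems.HurwitzMicroSectorsHurwitzSectorComplementStubSymReductionAlgebra

/-!
# `HurwitzSectorComplement` (stmt-KontsevichZagierPeriods-14341), line `galois-parity-half`,
# stub S1 `stub_symReduction` — part 4/4: the reduction to the symmetric normal form

The calculus half of Conjecture 1 on the symmetric Hurwitz tower. A representation
`[(0,1)^w, Q(t) + R(t)/(1 − t^N)]` (`t = x₀⋯x_{w−1}`, `w ≥ 2`, `deg R < N`, `R` `(−1)^w`-symmetric)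
of level `N ∣ L`, `L ≥ 3`, is moved to the NORMAL FORM
`[(0,1)^w, c + Σ_{a ∈ T_L} μ_a (t^{a−1} + (−1)^w t^{L−1−a})/(1 − t^L)]`,
`T_L = {0 < a < L/2, gcd(a, L) = 1}`, on the same open box, using only integrand additivity
(rule 1b) and the dilations `xᵢ ↦ xᵢ^g` (rule 2, the proved crux `DilationMove_of`), with all
rational rescalings inside the integrands:

* the kit `symReduction_kit` (part 1) supplies the level-`L` sector family `σ` and the
  `ℚ`-submodule `K` of numerators killed by the moves, containing the distribution polynomials
  (one dilation each) and the Jacobian polynomials (one dilation each);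
* `Q(t) + R(t)/(1 − t^N) = P(t)/(1 − t^L)` on the box with the level-`L` numerator
  `P = Q (1 − X^L) + R Σ_{j<L/N} X^{jN}` (`(1 − t^N) Σ_j t^{jN} = 1 − t^L`), so `r ∼ σ P` (congruence);
* `symReduction_algebra` (part 3; Kubert generation over `ℚ` with symmetric folding, part 2) gives
  `P − NF ∈ K` for the normal-form numerator `NF = c (1 − X^L) + Σ_{a ∈ T_L} μ_a (X^{a−1} + (−1)^w X^{L−1−a})`,
  so `σ P ∼ σ NF`, and `σ NF` has the normal-form integrand on the box.

No Newton–Leibniz move, no change of dimension, one domain throughout.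

References: M. Kontsevich, D. Zagier, *Periods* (2001), §1.2 rules (1b), (2); J. Milnor, Enseign.
Math. 29 (1983), §1; S. Lang, *Cyclotomic Fields I–II* (1990), Ch. 2 §8–9.
-/

noncomputable section

open Set MeasureTheory Polynomial
open scoped BigOperators
open Literature.NumberTheory.Transcendental

namespace Summit.KontsevichZagierPeriods.Theorems.HurwitzMicroSectorsHurwitzSectorComplement

open SymReduction

/-- **S1 (reduction half, calculus only).** Every symmetric representation of weight `w ≥ 2` and level
`N ∣ L` (`L ≥ 3`) is KZ-equivalent to a normal form on the primitive symmetric basis of level `L`: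
`[(0,1)^w, Q(t) + R(t)/(1−t^N)] ∼ [(0,1)^w, c + Σ_{a ∈ T_L} μ_a (t^{a−1} + (−1)^w t^{L−1−a})/(1−t^L)]`
by integrand additivity and the dilations `xᵢ ↦ xᵢ^g` only (distribution relations = single moves,
Jacobian monomials, Kubert generation over `ℚ` inside the integrands).
[cite: Milnor1983, §1] [cite: Lang1990, Ch. 2 §8–9] -/
theorem stub_symReduction : ∀ (w N L : ℕ), 2 ≤ w → 1 ≤ N → 3 ≤ L → N ∣ L → ∀ (r : KZ.IntegralRep w) (Q R : Polynomial ℚ), R.natDegree < N → (∀ i j : ℕ, i + j + 2 = N → R.coeff i = (-1 : ℚ) ^ w * R.coeff j) → (Odd w → R.coeff (N - 1) = 0) → r.domain = {x | ∀ i, x i ∈ Set.Ioo (0:ℝ) 1} → Set.EqOn r.integrand (fun x => Polynomial.aeval (∏ i, x i) Q + Polynomial.aeval (∏ i, x i) R / (1 - (∏ i, x i) ^ N)) r.domain → ∃ (c : ℚ) (μ : ℕ → ℚ) (r' : KZ.IntegralRep w), r'.domain = {x | ∀ i, x i ∈ Set.Ioo (0:ℝ) 1} ∧ Set.EqOn r'.integrand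 (fun x => (c : ℝ) + ∑ a ∈ (Finset.range L).filter (fun a => 2 * a < L ∧ Nat.Coprime a L), (μ a : ℝ) * (((∏ i, x i) ^ (a - 1) + (-1 : ℝ) ^ w * (∏ i, x i) ^ (L - 1 - a)) / (1 - (∏ i, x i) ^ L))) r'.domain ∧ KZ.Equivalent r r' := by
  intro w N L hw hN hL hNL r Q R hR hsym hodd hdom hint
  obtain ⟨σ, K, hσd, hσi, hrσ, hK, hD, hE⟩ := symReduction_kit w L hw (by omega)
  obtain ⟨d, hd⟩ := hNL
  have hdL : L / N = d := by rw [hd, Nat.mul_div_cancel_left d (by omega)]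
  obtain ⟨c, μ, hmem⟩ := symReduction_algebra w N L (by omega) hN hL ⟨d, hd⟩ K
    (fun p M β hp hpM _ => hD p M β hp.one_lt.le hpM) hE Q R hR hsym hodd
  refine ⟨c, μ, σ (C c * (1 - X ^ L) + ∑ a ∈ (Finset.range L).filter
      (fun a => 2 * a < L ∧ Nat.Coprime a L), C (μ a) * (X ^ (a - 1) + C ((-1 : ℚ) ^ w) * X ^ (L - 1 - a))),
    hσd _, fun x hx => ?_, ?_⟩
  · -- the normal-form integrand on the box
    rw [hσd] at hx
    have ht := BoxIntegral.prod_mem_Ioo (n := w) (by omega) hx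
    rw [hσi]
    simp only [map_add, map_mul, map_sub, map_one, map_pow, map_sum, Polynomial.aeval_C,
      Polynomial.aeval_X, eq_ratCast]
    generalize ∏ i, x i = t at ht ⊢
    have hL1 : (1 : ℝ) - t ^ L ≠ 0 := one_sub_pow_ne_zero ht (by omega)
    rw [add_div, mul_div_assoc, div_self hL1, mul_one, Finset.sum_div]
    push_cast
    exact congrArg₂ (· + ·) rfl (Finset.sum_congr rfl fun a _ => by rw [mul_div_assoc])
  · -- `r ∼ σ P ∼ σ NF`
    refine KZ.Equivalent.trans (hrσ r (Q * (1 - X ^ L) + R * ∑ j ∈ Finset.range (L / N), X ^ (j * N))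
      hdom fun x hx => ?_) (hK _ _ hmem)
    rw [hint hx]
    rw [hdom] at hx
    have ht := BoxIntegral.prod_mem_Ioo (n := w) (by omega) hx
    simp only [map_add, map_mul, map_sub, map_one, map_pow, map_sum, Polynomial.aeval_X]
    generalize ∏ i, x i = t at ht ⊢
    have hN1 : (1 : ℝ) - t ^ N ≠ 0 := one_sub_pow_ne_zero ht (by omega)
    have hG : (∑ j ∈ Finset.range (L / N), t ^ (j * N)) * (1 - t ^ N) = 1 - t ^ L := by
      rw [hdL, Finset.sum_congr rfl fun j _ => show t ^ (j * N) = (t ^ N) ^ j by rw [← pow_mul, mul_comm],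
        geom_sum_mul_neg, ← pow_mul, ← hd]
    have hGne : ∑ j ∈ Finset.range (L / N), t ^ (j * N) ≠ 0 :=
      (Finset.sum_pos (fun j _ => pow_pos ht.1 _) (Finset.nonempty_range_iff.mpr (by
        rw [hdL]; rintro rfl; rw [mul_zero] at hd; omega))).ne'
    rw [← hG]
    field_simp

end Summit.KontsevichZagierPeriods.Theorems.HurwitzMicroSectorsHurwitzSectorComplement

end
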